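import Summits.HodgeConjecture.HodgeConjecture.Theorems.PeriodDeficiencyQbarGenericIsHodgeGenericCoverFact
import HarnessLib

/-!
# Crux `QbarGenericIsHodgeGeneric` (HGQ, stmt-HodgeConjecture-11595), line `registered`, reshape r5:
# the two named countability facts are EQUIVALENT (the converse direction)

Helper file (`--supports stmt-HodgeConjecture-11595`) of the line lead c2. Reshape r5 replaced the r4
residual named fact `Motives.countable_specialSubvarieties_meeting_affineOpen` ("the special
subvarieties meeting an affine chart are countably many", p154148) by the printed Cattani–Deligne–Kaplan /
Baldi–Klingler–Ullmo statement in cover form, `Motives.cdk1995_nonHodgeGenericLocus_countableCover`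
(p161402), and PROVED the r4 fact from it (`countable_specialSubvarieties_meeting_affineOpen_of_coverFact_holds`,
p162023). This file proves the CONVERSE, so that the two facts are equivalent modulo mathematics proved
in the tree — the reshape changed the residual debt's form (literal, printed), not its logical strength:

* `exists_maximal_irreducibleZariskiClosedOnPoints` — every non-empty family of irreducible
  Zariski-closed sets of complex points of a smooth `ℂ`-scheme has a maximal member (ACC; the argument
  of `stub_irredClosed_hasMaximal`, p147844, freed from the `ℚ̄`-structure);
* `exists_specialClosure_of_bddAbove` — special closure of a point for any VHS datum with bounded
  ranks on such a base (the argument of `exists_specialClosure`, p156821);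
* `cover_of_countable_special` — if the special subvarieties meeting the affine chart `U` are countably
  many, the non-generic locus of every irreducible closed `Z` meeting `U` is covered over `U` by the
  countably many special subvarieties meeting `U` and not containing `Z` (the special closure `Y_z` of a
  non-generic `z ∈ Z` cannot contain `Z`: `genericMTRank Z ≤ genericMTRank Y_z ≤ mtRankAt z`);
* `coverFact_of_countable_specialSubvarieties_meeting_affineOpen` and
  `cdk1995_nonHodgeGenericLocus_countableCover_iff` — **r5 fact ⟺ r4 fact**.

## References
* [BaldiKlinglerUllmo2024] G. Baldi, B. Klingler, E. Ullmo, Invent. Math. 235 (2024), Thm. 1.1, §3.2,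
  §3.4, Lemma 3.6.
* [CattaniDeligneKaplan1995JAMS] E. Cattani, P. Deligne, A. Kaplan, JAMS 8 (1995), Thm. 1.1, Cor. 1.2.
-/

noncomputable section

-- every declaration of this problem lives in `Summit.HodgeConjecture.HodgeConjecture.…` (problem = summit)
set_option linter.dupNamespace false

namespace Summit.HodgeConjecture.HodgeConjecture.Theorems

open CategoryTheory AlgebraicGeometry
open Literature.AlgebraicGeometry.Motives Literature.AlgebraicGeometry.HodgeTheory
open _root_.Topology

/-! ### ACC on irreducible Zariski-closed sets of points of a smooth `ℂ`-scheme -/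

/-- **Maximal members of families of irreducible closed algebraic subvarieties** (on complex points):
for `S` smooth over `ℂ` (hence locally Noetherian), every non-empty family of irreducible
Zariski-closed sets of points of `S` has a maximal member — a strictly increasing sequence in the
family would give a strictly increasing sequence of irreducible closed subsets of `S` (closures of the
underlying points), contradicting `exists_succ_subset_of_isIrreducible_isClosed` (p147844).
[cite: BaldiKlinglerUllmo2024, §3.1] -/
theorem exists_maximal_irreducibleZariskiClosedOnPoints {S : SchemeOver ℂ}
    (hsm : AlgebraicGeometry.Smooth S.hom) (F : Set (Set (ComplexPoints S))) (hF : F.Nonempty)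
    (hirr : ∀ A ∈ F, IsIrreducibleZariskiClosedOnPoints S A) :
    ∃ M ∈ F, ∀ A ∈ F, M ⊆ A → A = M := by
  haveI := hsm
  haveI : IsLocallyNoetherian S.left := LocallyOfFiniteType.isLocallyNoetherian S.hom
  by_contra h
  push Not at h
  -- a strictly increasing sequence `Y` in `F`
  choose! next hnext hsub hne using h
  obtain ⟨A₀, hA₀⟩ := hF
  obtain ⟨Y, hY₀, hYsucc⟩ : ∃ Y : ℕ → Set (ComplexPoints S), Y 0 = A₀ ∧ ∀ k, Y (k + 1) = next (Y k) :=
    ⟨fun k => next^[k] A₀, rfl, fun k => Function.iterate_succ_apply' next k A₀⟩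
  have hY : ∀ k, Y k ∈ F := by
    intro k
    induction k with
    | zero => exact hY₀ ▸ hA₀
    | succ k ih => exact hYsucc k ▸ hnext _ ih
  have hYmono : ∀ k, Y k ⊆ Y (k + 1) := fun k => by
    rw [hYsucc]
    exact hsub _ (hY k)
  -- the closures of the underlying points: an increasing chain of irreducible closed subsets of `S`
  have hf : Continuous (fun P : ZariskiPoints S ℂ => P.val.pt) := continuous_induced_dom
  obtain ⟨k, hk⟩ := exists_succ_subset_of_isIrreducible_isClosed
    (fun k => closure ((fun P : ZariskiPoints S ℂ => P.val.pt) '' zariskiSet S (Y k)))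
    (fun _ => isClosed_closure)
    (fun k => ((hirr _ (hY k)).2.image _ hf.continuousOn).closure)
    (fun k => closure_mono (Set.image_mono (Set.preimage_mono (hYmono k))))
  -- hence `Y (k+1) ⊆ Y k`, contradicting strictness
  apply hne _ (hY k)
  rw [← hYsucc k]
  refine le_antisymm (fun P hP => ?_) (hYmono k)
  obtain ⟨C, hC, hCY⟩ := isClosed_induced_iff.mp (hirr _ (hY k)).1
  have hZC : closure ((fun P : ZariskiPoints S ℂ => P.val.pt) '' zariskiSet S (Y k)) ⊆ C := by
    refine closure_minimal ?_ hC
    rintro _ ⟨Q, hQ, rfl⟩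
    rw [← hCY] at hQ
    exact hQ
  have hP' : (show ZariskiPoints S ℂ from P) ∈ (fun P : ZariskiPoints S ℂ => P.val.pt) ⁻¹' C :=
    hZC (hk (subset_closure ⟨_, hP, rfl⟩))
  rw [hCY] at hP'
  exact hP'

/-! ### Special closure of a point, for any VHS datum with bounded ranks -/

/-- **The special closure of a point** for a VHS datum `D` with bounded Mumford–Tate ranks on the
complex points of a smooth `ℂ`-scheme: every `s` lies in a special subvariety
(`VHSData.IsSpecialSubvariety`, BKU Def. 3.3 / Lemma 3.6) `Y` with `D.mtRankAt ≤ D.mtRankAt s` on `Y` —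
a maximal member (`exists_maximal_irreducibleZariskiClosedOnPoints`) of the irreducible closed sets
through `s` on which the rank is bounded by the rank at `s` (`{s}` qualifies,
`singleton_isIrreducibleZariskiClosedOnPoints`). The argument of `exists_specialClosure` (p156821)
without the `ℚ̄`-structure. [cite: BaldiKlinglerUllmo2024, §3.2 and Lemma 3.6] -/
theorem exists_specialClosure_of_bddAbove [HodgeTensorFacts.{0, 0}] {S : SchemeOver ℂ} {w : ℤ}
    (D : VHSData (ComplexPoints S) w) [∀ s, Module.Finite ℚ (D.V.fiber s)]
    (hsm : AlgebraicGeometry.Smooth S.hom)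
    (hbdd : BddAbove (Set.range fun s : ComplexPoints S => D.mtRankAt s)) (s : ComplexPoints S) :
    ∃ Y : Set (ComplexPoints S), s ∈ Y ∧ D.IsSpecialSubvariety Y ∧ ∀ y ∈ Y, D.mtRankAt y ≤ D.mtRankAt s := by
  haveI := hsm
  haveI : LocallyOfFiniteType S.hom := inferInstance
  set F : Set (Set (ComplexPoints S)) :=
    {Y | s ∈ Y ∧ IsIrreducibleZariskiClosedOnPoints S Y ∧ ∀ y ∈ Y, D.mtRankAt y ≤ D.mtRankAt s} with hF
  have hsF : ({s} : Set _) ∈ F :=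
    ⟨Set.mem_singleton s, singleton_isIrreducibleZariskiClosedOnPoints s,
      fun y hy => (congrArg D.mtRankAt (Set.mem_singleton_iff.mp hy)).le⟩
  obtain ⟨M, hMF, hMmax⟩ :=
    exists_maximal_irreducibleZariskiClosedOnPoints hsm F ⟨{s}, hsF⟩ fun A hA => hA.2.1
  refine ⟨M, hMF.1, ⟨hMF.2.1, fun Z hZ hMZ => ?_⟩, hMF.2.2⟩
  -- `Z ⊋ M` irreducible closed is not in `F`, so some point of `Z` has rank `> mtRankAt s`
  have hZF : Z ∉ F := fun hZF => hMZ.ne (hMmax Z hZF hMZ.le).symm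
  have hz : ∃ z ∈ Z, D.mtRankAt s < D.mtRankAt z := by
    by_contra hcon
    push Not at hcon
    exact hZF ⟨hMZ.le hMF.1, hZ, hcon⟩
  obtain ⟨z, hzZ, hsz⟩ := hz
  have hbZ : BddAbove (Set.range fun y : Z => D.mtRankAt y) := by
    obtain ⟨C, hC⟩ := hbdd
    exact ⟨C, by rintro _ ⟨y, rfl⟩; exact hC ⟨y, rfl⟩⟩
  have h1 : D.genericMTRank M ≤ D.mtRankAt s := by
    haveI : Nonempty M := ⟨⟨s, hMF.1⟩⟩
    exact ciSup_le fun y => hMF.2.2 y y.2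
  have h2 : D.mtRankAt z ≤ D.genericMTRank Z := D.mtRankAt_le_genericMTRank hbZ hzZ
  omega

/-! ### The cover of the non-generic loci from countability of the special subvarieties -/

/-- **Countability of the special subvarieties meeting a chart gives the cover of the non-generic
loci** (the converse of the descent `stub_countable_special_of_cover`, p160729): if the special
subvarieties for `D` meeting `U(ℂ)` are countably many (and the ranks are bounded), then for every
irreducible Zariski-closed `Z` meeting `U(ℂ)` there are countably many Zariski-closed `W k ⊉ Z`
containing every `z ∈ Z` over `U` with `mtRankAt z < genericMTRank Z` — namely the special
subvarieties meeting `U` not containing `Z`: the special closure `Y_z ∋ z`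
(`exists_specialClosure_of_bddAbove`) has `genericMTRank Y_z ≤ mtRankAt z < genericMTRank Z`, so
`Z ⊄ Y_z` (`genericMTRank_mono`). [cite: BaldiKlinglerUllmo2024, §3.2, §3.4 and Lemma 3.6] -/
theorem cover_of_countable_special [HodgeTensorFacts.{0, 0}] {S : SchemeOver ℂ} {w : ℤ}
    (D : VHSData (ComplexPoints S) w) [∀ s, Module.Finite ℚ (D.V.fiber s)]
    (hsm : AlgebraicGeometry.Smooth S.hom) (U : S.left.Opens)
    (hbdd : BddAbove (Set.range fun s : ComplexPoints S => D.mtRankAt s))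
    (hcount : {Y : Set (ComplexPoints S) | D.IsSpecialSubvariety Y ∧ ∃ y ∈ Y, y.pt ∈ U}.Countable)
    {Z : Set (ComplexPoints S)} (hZne : Z.Nonempty) :
    ∃ W : ℕ → Set (ComplexPoints S), (∀ k, IsZariskiClosedOnPoints S (W k) ∧ ¬ Z ⊆ W k) ∧
      ∀ z ∈ Z, z.pt ∈ U → D.mtRankAt z < D.genericMTRank Z → ∃ k, z ∈ W k := by
  -- the special subvarieties meeting `U` and not containing `Z`: a countable set `𝒴`
  set 𝒴 : Set (Set (ComplexPoints S)) :=
    {Y | (D.IsSpecialSubvariety Y ∧ ∃ y ∈ Y, y.pt ∈ U) ∧ ¬ Z ⊆ Y} with h𝒴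
  have h𝒴c : 𝒴.Countable := hcount.mono fun Y hY => hY.1
  -- every non-generic `z ∈ Z` over `U` lies in a member of `𝒴`
  have hcov : ∀ z ∈ Z, z.pt ∈ U → D.mtRankAt z < D.genericMTRank Z → ∃ Y ∈ 𝒴, z ∈ Y := by
    intro z hz hzU hlt
    obtain ⟨Y, hzY, hYsp, hle⟩ := exists_specialClosure_of_bddAbove D hsm hbdd z
    refine ⟨Y, ⟨⟨hYsp, z, hzY, hzU⟩, fun hZY => ?_⟩, hzY⟩
    have h1 : D.genericMTRank Y ≤ D.mtRankAt z := by
      haveI : Nonempty Y := ⟨⟨z, hzY⟩⟩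
      exact ciSup_le fun y => hle y y.2
    have h2 : D.genericMTRank Z ≤ D.genericMTRank Y := genericMTRank_mono D hbdd hZY ⟨z, hz⟩
    omega
  -- enumerate `𝒴` (padding with `∅` when it is empty)
  rcases Set.eq_empty_or_nonempty 𝒴 with h0 | hne
  · obtain ⟨z₀, hz₀⟩ := hZne
    refine ⟨fun _ => ∅, fun _ => ⟨isZariskiClosedOnPoints_empty S, fun h => h hz₀⟩, ?_⟩
    intro z hz hzU hlt
    obtain ⟨Y, hY, -⟩ := hcov z hz hzU hlt
    rw [h0] at hY
    exact hY.elim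
  · obtain ⟨W, hW⟩ := h𝒴c.exists_eq_range hne
    refine ⟨W, fun k => ?_, fun z hz hzU hlt => ?_⟩
    · have hk : W k ∈ 𝒴 := hW ▸ Set.mem_range_self k
      exact ⟨(isZariskiClosedOnPoints_iff_isClosed _).2 hk.1.1.1.1, hk.2⟩
    · obtain ⟨Y, hY, hzY⟩ := hcov z hz hzU hlt
      rw [hW] at hY
      obtain ⟨k, rfl⟩ := hY
      exact ⟨k, hzY⟩

/-- **r4 fact ⟹ r5 fact**: `Motives.countable_specialSubvarieties_meeting_affineOpen` implies
`Motives.cdk1995_nonHodgeGenericLocus_countableCover` — on a smooth irreducible `ℂ`-scheme of some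
relative dimension (`exists_smoothOfRelativeDimension_of_smooth`) the complex points form a connected
(`connectedSpace_complexPoints_of_irreducibleSpace`, SGA1 XII 2.4) topological manifold, hence a path
connected space, so the ranks are bounded (`mtRankAt_le_of_pathConnectedSpace`) and
`cover_of_countable_special` applies. [cite: BaldiKlinglerUllmo2024, Thm. 1.1, §3.2 and §3.4] -/
theorem coverFact_of_countable_specialSubvarieties_meeting_affineOpen :
    countable_specialSubvarieties_meeting_affineOpen → cdk1995_nonHodgeGenericLocus_countableCover := by
  intro hA B hB _ 𝒳 S f n i D _ hirr hsm U hU Z _ hZU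
  haveI := hirr
  haveI := hsm
  haveI : LocallyOfFiniteType S.hom := inferInstance
  obtain ⟨m, hm⟩ := Literature.AlgebraicGeometry.Motives.exists_smoothOfRelativeDimension_of_smooth S.hom
  haveI := hm
  haveI : ConnectedSpace (ComplexPoints S) := connectedSpace_complexPoints_of_irreducibleSpace S
  haveI : PathConnectedSpace (ComplexPoints S) :=
    pathConnectedSpace_complexPoints_of_smoothOfRelativeDimension S m
  obtain ⟨z₀, hz₀, -⟩ := hZU
  have hbdd : BddAbove (Set.range fun s : ComplexPoints S => D.mtRankAt s) :=
    ⟨_, by rintro _ ⟨y, rfl⟩; exact mtRankAt_le_of_pathConnectedSpace D.toVHSData z₀ y⟩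
  exact cover_of_countable_special D.toVHSData hsm U hbdd (hA B hB f n i D hirr hsm U hU) ⟨z₀, hz₀⟩

/-- **The two named countability facts of the tree are equivalent** (modulo mathematics proved in
the tree): the r5 cover form `Motives.cdk1995_nonHodgeGenericLocus_countableCover` (Cattani–Deligne–Kaplan
1995 / Baldi–Klingler–Ullmo 2024 Thm. 1.1 as printed) and the r4 count form
`Motives.countable_specialSubvarieties_meeting_affineOpen` (BKU §3.4) —
`countable_specialSubvarieties_meeting_affineOpen_of_coverFact_holds` (descent, p160729 + p162023) and
`coverFact_of_countable_specialSubvarieties_meeting_affineOpen` (special closures). So reshape r5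
changed the form of the line's residual known-mathematics debt, not its strength.
[cite: BaldiKlinglerUllmo2024, Thm. 1.1 and §3.4] -/
theorem cdk1995_nonHodgeGenericLocus_countableCover_iff :
    cdk1995_nonHodgeGenericLocus_countableCover ↔ countable_specialSubvarieties_meeting_affineOpen :=
  ⟨countable_specialSubvarieties_meeting_affineOpen_of_coverFact_holds,
    coverFact_of_countable_specialSubvarieties_meeting_affineOpen⟩

end Summit.HodgeConjecture.HodgeConjecture.Theorems

end
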